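import Mathlib
import HarnessLib
import Summits.Ventures.LatticeQCDFlow.Exactness.TransformedKernel
import Summits.Ventures.LatticeQCDFlow.Exactness.CheckerboardSweep
import Summits.Ventures.LatticeQCDFlow.Exactness.KickAngleJacobian
import Summits.Ventures.LatticeQCDFlow.Exactness.SphereGeodesicKick
import Summits.Ventures.LatticeQCDFlow.Exactness.SphereKickJacobian
import Summits.Ventures.LatticeQCDFlow.Exactness.SphereKickJacobianTransport
import Summits.Ventures.LatticeQCDFlow.Exactness.SphereKickTHMC

/-!
# The Engel–Schaefer checkerboard sweep of leading-order site updates on a product of site spheres: a measurable bijection with exact Jacobian = the product of the eq. (18) factors, so THMC with it is exact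

HONEST FRAMING: exact (Metropolis-corrected) sampling algorithms for lattice gauge theory;
figures of merit are autocorrelation/cost numbers at stated couplings and volumes; no
continuum-physics claim.

Venture `LatticeQCDFlow` (cell pub-lqcd), topic `Exactness`; FANOUT row 7 (`s0-cpn-null`: the
S0-D1 rung — 2D CP⁹, Lüscher's LO trivializing map inside HMC, Engel–Schaefer 2011).  NEW WORK of
the cell: the ASSEMBLY of `Exactness/CheckerboardSweep.lean` (`sweepEquiv`,
`hasJacobian_sweepEquiv`: a two-class sweep of single-site measurable bijections with exact
single-site Jacobians is a measurable bijection of the configuration space with Jacobian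
`sweepJac` = product of the per-site factors on the CURRENT field) with
`Exactness/SphereKickTHMC.lean` / `SphereKickJacobianTransport.lean` (the E–S site update IS such
a bijection of the site sphere, with the eq. (18) factor as exact Jacobian against the surface
measure, for every local field with `|c| ‖J‖ ≤ 1`) and `Exactness/TransformedKernel.lean`
(`transformedUpdate_invariant/_isReversible`).  Nothing is cited as a fact.  Printed counterpart,
NAMED ONLY: Engel–Schaefer, Comput. Phys. Commun. 182 (2011) 2107, §3: `x = F(y)` = the site step
(17) swept through the lattice, `S_eff = S(F(y)) − Σ_n ln det 𝒥_n` with the factors (18).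

## Setting

Sites `ι` (finite), site space the unit sphere `S(V)` of a real inner product space `V` with
`dim V = n + 2` (CP(N−1): `V = ℂ^N ≅ ℝ^{2N}`, `n = 2N − 2`), reference measure `⊗_ι μ.toSphere` for
an additive Haar measure `μ` on `V`; two classes `p`, `q` of sites (even / odd); for each class a
`SiteLocalField`: for every active site a CONTINUOUS function `J a` of the frozen sites' values (the
local field built from the neighbours — for CP(N−1) the link-weighted neighbour sum) inside the
bijectivity range `|c| ‖J a y‖ ≤ 1` (the pre-registered map constant).

## Content

* `continuous_geodesicKick₂`, `continuous_sphereKick₂` (joint continuity in (field, site)),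
  `measurable_angle₂`, `measurable_kickJac₂`; **`continuous_symm_apply_of_compact`** — a
  continuous family of self-bijections of a compact Hausdorff space over a compact Hausdorff
  parameter space has a jointly continuous inverse (one more continuous bijection of a compact
  space); this supplies the measurability of the INVERSE site maps that `sweepEquiv` asks for.
* `SiteLocalField`, `classKick` (the class's site maps as `S(V) ≃ᵐ S(V)`, `SphereKickTHMC.sphereKickEquiv`),
  `classJac` (the eq. (18) factors), their joint measurability, nonnegativity and per-site
  `HasJacobian` (`hasJacobian_classKick`).
* **`kickSweepEquiv`** — the E–S sweep (class `p`, local fields recomputed, class `q`) as a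
  measurable equivalence of `ι → S(V)`; **`hasJacobian_kickSweepEquiv`** — its exact Jacobian
  w.r.t. `⊗_ι μ.toSphere` is `sweepJac` of the eq. (18) factors (the code's `Σ_n ln det 𝒥_n`,
  `CheckerboardSweep.log_sweepJac`).
* **`kickSweep_thmc_invariant`** / **`kickSweep_thmc_isReversible`** — THMC WITH THE E–S SWEEP IS
  EXACT: any update of the pulled-back variables leaving `(P ∘ F) · sweepJac · ⊗ μ.toSphere`
  invariant (resp. reversible), reported through the sweep `F`, leaves `P · ⊗ μ.toSphere` invariant
  (resp. reversible), for every measurable configuration weight `P ≥ 0`.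

NOT CLAIMED: the U(1) link variables of the CP(N−1) action (here the local fields are any
continuous functions of the frozen site variables; links would be further frozen spectators), more
than two classes / several Euler steps (iterate: `HasJacobian.comp`, `HasJacobian.iterate`), the
HMC kernel itself, anything quantitative about autocorrelations.
-/

noncomputable section

namespace Summit.Ventures.LatticeQCDFlow.Exactness

open Real Set MeasureTheory Measure InnerProductGeometry Metric ProbabilityTheory
  ProbabilityTheory.Kernel Summit.Ventures.LatticeQCDFlow.Theory2
open scoped ENNReal InnerProductSpace

/-! ## §1 Joint continuity and measurability; inverses of compact families of bijections -/

section Joint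

variable {V : Type*} [NormedAddCommGroup V] [InnerProductSpace ℝ V]

/-- The tangential part of the field is jointly continuous in (field, site). -/
theorem continuous_tangentKick₂ : Continuous fun z : V × V => tangentKick z.1 z.2 := by
  unfold tangentKick
  exact continuous_fst.sub ((continuous_fst.inner continuous_snd).smul continuous_snd)

/-- **The LO site update is jointly continuous in (field, site)** (removable singularity via
`SphereKickJacobian.sin_div_norm_smul_eq_sinc`). -/
theorem continuous_geodesicKick₂ (c : ℝ) : Continuous fun z : V × V => geodesicKick c z.1 z.2 := by
  have hp := continuous_tangentKick₂ (V := V)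
  have hn : Continuous fun z : V × V => c * ‖tangentKick z.1 z.2‖ :=
    continuous_const.mul (continuous_norm.comp hp)
  have h : (fun z : V × V => geodesicKick c z.1 z.2) = fun z =>
      cos (c * ‖tangentKick z.1 z.2‖) • z.2 +
        (c * sinc (c * ‖tangentKick z.1 z.2‖)) • tangentKick z.1 z.2 := by
    funext z
    rw [geodesicKick, sin_div_norm_smul_eq_sinc]
  rw [h]
  exact ((continuous_cos.comp hn).smul continuous_snd).add
    ((continuous_const.mul (continuous_sinc.comp hn)).smul hp)

/-- The update as a self-map of the sphere is jointly continuous in (field, site). -/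
theorem continuous_sphereKick₂ (c : ℝ) :
    Continuous fun z : V × sphere (0 : V) 1 => sphereKick c z.1 z.2 :=
  ((continuous_geodesicKick₂ c).comp
    (continuous_fst.prodMk (continuous_subtype_val.comp continuous_snd))).subtype_mk _

variable [FiniteDimensional ℝ V] [MeasurableSpace V] [BorelSpace V]

/-- The angle is jointly measurable. -/
theorem measurable_angle₂ : Measurable fun z : V × V => angle z.1 z.2 := by
  have h1 : Continuous fun z : V × V => ⟪z.1, z.2⟫_ℝ := continuous_fst.inner continuous_snd
  have h2 : Continuous fun z : V × V => ‖z.1‖ * ‖z.2‖ :=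
    (continuous_norm.comp continuous_fst).mul (continuous_norm.comp continuous_snd)
  exact Real.continuous_arccos.measurable.comp (h1.measurable.div h2.measurable)

omit [FiniteDimensional ℝ V] [MeasurableSpace V] [BorelSpace V] in
/-- The printed factor `kickJac κ m θ` is jointly measurable in `(κ, θ)`. -/
theorem measurable_kickJac₂ (m : ℕ) : Measurable fun z : ℝ × ℝ => kickJac z.1 m z.2 := by
  have hk : Measurable fun z : ℝ × ℝ => kickAngle z.1 z.2 :=
    measurable_snd.sub (measurable_fst.mul (measurable_sin.comp measurable_snd))
  unfold kickJac
  exact (measurable_const.sub (measurable_fst.mul (measurable_cos.comp measurable_snd))).mul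
    (((measurable_sin.comp hk).div (measurable_sin.comp measurable_snd)).pow_const m)

end Joint

/-- **Inverses of a compact family of bijections are jointly continuous.**  If `e y` is a
self-bijection of a compact Hausdorff space `X` for every `y` in a compact Hausdorff space `Y`, and
`(x, y) ↦ e y x` is jointly continuous, then so is `(x, y) ↦ (e y)⁻¹ x` — because
`(x, y) ↦ (e y x, y)` is a continuous bijection of the compact Hausdorff space `X × Y`, hence a
homeomorphism (`Continuous.homeoOfEquivCompactToT2`). -/
theorem continuous_symm_apply_of_compact {X Y : Type*} [TopologicalSpace X] [CompactSpace X]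
    [T2Space X] [TopologicalSpace Y] [CompactSpace Y] [T2Space Y] (e : Y → X ≃ X)
    (he : Continuous fun z : X × Y => e z.2 z.1) :
    Continuous fun z : X × Y => (e z.2).symm z.1 := by
  let Φ : X × Y ≃ X × Y :=
    { toFun := fun z => (e z.2 z.1, z.2)
      invFun := fun z => ((e z.2).symm z.1, z.2)
      left_inv := fun z => by simp
      right_inv := fun z => by simp }
  have hΦ : Continuous Φ := he.prodMk continuous_snd
  exact continuous_fst.comp (Continuous.homeoOfEquivCompactToT2 hΦ).symm.continuous

/-- The same for a family of measurable equivalences. -/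
theorem continuous_symm_apply_of_compact' {X Y : Type*} [TopologicalSpace X] [CompactSpace X]
    [T2Space X] [MeasurableSpace X] [TopologicalSpace Y] [CompactSpace Y] [T2Space Y]
    (e : Y → X ≃ᵐ X) (he : Continuous fun z : X × Y => e z.2 z.1) :
    Continuous fun z : X × Y => (e z.2).symm z.1 :=
  continuous_symm_apply_of_compact (fun y => (e y).toEquiv) he

/-! ## §2 One class of site updates -/

section Class

variable (n : ℕ) {V : Type*} [NormedAddCommGroup V] [InnerProductSpace ℝ V] [FiniteDimensional ℝ V]
  [MeasurableSpace V] [BorelSpace V] (hV : Module.finrank ℝ V = n + 2) (c : ℝ)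
  {ι : Type*} {p : ι → Prop}

/-- **Local-field data for one class of sites**: for each active site `a`, the local field
`J a y ∈ V` as a CONTINUOUS function of the frozen sites' values `y` (for CP(N−1): the
link-weighted sum over the neighbours, all in the other class), inside the bijectivity range
`|c| ‖J a y‖ ≤ 1` of the single-site update (the pre-registered map constant). -/
structure SiteLocalField (V : Type*) [NormedAddCommGroup V] [InnerProductSpace ℝ V] (c : ℝ)
    {ι : Type*} (p : ι → Prop) where
  /-- the local field at the active site `a` given the frozen configuration -/
  J : {i // p i} → (({i // ¬p i}) → sphere (0 : V) 1) → V
  /-- it depends continuously on the frozen configuration -/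
  continuous : ∀ a, Continuous (J a)
  /-- it stays inside the bijectivity range of the site update -/
  norm_le : ∀ a y, |c| * ‖J a y‖ ≤ 1

variable (L : SiteLocalField V c p)

omit [FiniteDimensional ℝ V] [MeasurableSpace V] [BorelSpace V] in
/-- The local field as a function of (site value, frozen configuration) is continuous (it ignores
the site value).  (Stated with the composition spelled out: elaborating `(L.continuous a).comp
continuous_snd` against this goal makes the unifier unfold the structure projection.) -/
theorem SiteLocalField.continuous_snd (a : {i // p i}) :
    Continuous fun z : sphere (0 : V) 1 × ({i // ¬p i} → sphere (0 : V) 1) => L.J a z.2 :=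
  Continuous.comp (f := Prod.snd) (g := L.J a) (L.continuous a) _root_.continuous_snd

/-- The class's site updates as measurable equivalences of the site sphere
(`SphereKickTHMC.sphereKickEquiv`), indexed by the active site and the frozen configuration. -/
def classKick (a : {i // p i}) (y : {i // ¬p i} → sphere (0 : V) 1) :
    sphere (0 : V) 1 ≃ᵐ sphere (0 : V) 1 :=
  sphereKickEquiv n hV (L.norm_le a y)

/-- The site update is the E–S kick at the local field. -/
@[simp] theorem classKick_apply (a : {i // p i}) (y : {i // ¬p i} → sphere (0 : V) 1)
    (g : sphere (0 : V) 1) : classKick n hV c L a y g = sphereKick c (L.J a y) g := rfl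

/-- The eq. (18) factor of the site update at the local field. -/
def classJac (a : {i // p i}) (y : {i // ¬p i} → sphere (0 : V) 1) (g : sphere (0 : V) 1) : ℝ :=
  kickJac (c * ‖L.J a y‖) n (angle (L.J a y) (g : V))

/-- The site updates are jointly continuous in (site value, frozen configuration) … -/
theorem continuous_classKick (a : {i // p i}) :
    Continuous fun z : sphere (0 : V) 1 × ({i // ¬p i} → sphere (0 : V) 1) =>
      classKick n hV c L a z.2 z.1 := by
  have h : Continuous fun z : sphere (0 : V) 1 × ({i // ¬p i} → sphere (0 : V) 1) =>
      sphereKick c (L.J a z.2) z.1 :=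
    Continuous.comp (g := fun w : V × sphere (0 : V) 1 => sphereKick c w.1 w.2)
      (f := fun z : sphere (0 : V) 1 × ({i // ¬p i} → sphere (0 : V) 1) => (L.J a z.2, z.1))
      (continuous_sphereKick₂ c) ((L.continuous_snd c a).prodMk _root_.continuous_fst)
  simpa only [classKick_apply] using h

/-- … hence jointly measurable. -/
theorem measurable_classKick [Finite ι] (a : {i // p i}) :
    Measurable fun z : sphere (0 : V) 1 × ({i // ¬p i} → sphere (0 : V) 1) =>
      classKick n hV c L a z.2 z.1 :=
  (continuous_classKick n hV c L a).measurable

/-- So are their inverses (compactness of the site sphere and of the frozen configuration space). -/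
theorem measurable_classKick_symm [Finite ι] (a : {i // p i}) :
    Measurable fun z : sphere (0 : V) 1 × ({i // ¬p i} → sphere (0 : V) 1) =>
      (classKick n hV c L a z.2).symm z.1 :=
  (continuous_symm_apply_of_compact' (classKick n hV c L a) (continuous_classKick n hV c L a)).measurable

/-- The eq. (18) factors are jointly measurable. -/
theorem measurable_classJac [Finite ι] (a : {i // p i}) :
    Measurable fun z : sphere (0 : V) 1 × ({i // ¬p i} → sphere (0 : V) 1) =>
      classJac n c L a z.2 z.1 := by
  unfold classJac
  have hJ : Measurable fun z : sphere (0 : V) 1 × ({i // ¬p i} → sphere (0 : V) 1) => L.J a z.2 :=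
    (L.continuous_snd c a).measurable
  exact (measurable_kickJac₂ n).comp ((measurable_const.mul hJ.norm).prodMk
    (measurable_angle₂.comp (hJ.prodMk (continuous_subtype_val.comp continuous_fst).measurable)))

omit [FiniteDimensional ℝ V] [MeasurableSpace V] [BorelSpace V] in
/-- The eq. (18) factors are nonnegative (`KickAngleJacobian.kickJac_nonneg`). -/
theorem classJac_nonneg (a : {i // p i}) (y : {i // ¬p i} → sphere (0 : V) 1)
    (g : sphere (0 : V) 1) : 0 ≤ classJac n c L a y g :=
  kickJac_nonneg (by rw [abs_mul, abs_norm]; exact L.norm_le a y) n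
    ⟨angle_nonneg _ _, angle_le_pi _ _⟩

/-- **Per-site exact Jacobian** (`SphereKickTHMC.hasJacobian_sphereKickEquiv`): every site update
of the class has the eq. (18) factor as exact Jacobian w.r.t. `μ.toSphere`. -/
theorem hasJacobian_classKick (μ : Measure V) [μ.IsAddHaarMeasure] (a : {i // p i})
    (y : {i // ¬p i} → sphere (0 : V) 1) :
    HasJacobian μ.toSphere (classKick n hV c L a y) fun g => ENNReal.ofReal (classJac n c L a y g) :=
  hasJacobian_sphereKickEquiv n hV μ (L.norm_le a y)

end Class

/-! ## §3 The two-class sweep and THMC -/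

section Sweep

variable (n : ℕ) {V : Type*} [NormedAddCommGroup V] [InnerProductSpace ℝ V] [FiniteDimensional ℝ V]
  [MeasurableSpace V] [BorelSpace V] (hV : Module.finrank ℝ V = n + 2) (c : ℝ)
  {ι : Type*} [Fintype ι] {p q : ι → Prop} [DecidablePred p] [DecidablePred q]
  (L₁ : SiteLocalField V c p) (L₂ : SiteLocalField V c q)

/-- **The Engel–Schaefer checkerboard sweep** — class `p` updated site by site at the local fields
of the frozen class, local fields recomputed, class `q` updated — as a measurable equivalence of
the configuration space `ι → S(V)` (`CheckerboardSweep.sweepEquiv`). -/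
def kickSweepEquiv : (ι → sphere (0 : V) 1) ≃ᵐ (ι → sphere (0 : V) 1) :=
  sweepEquiv (classKick n hV c L₁) (measurable_classKick n hV c L₁)
    (measurable_classKick_symm n hV c L₁) (classKick n hV c L₂) (measurable_classKick n hV c L₂)
    (measurable_classKick_symm n hV c L₂)

/-- The underlying map of the sweep: the two coupling layers of site kicks. -/
theorem coe_kickSweepEquiv :
    ⇑(kickSweepEquiv n hV c L₁ L₂) =
      coupleFun q (fun a y g => sphereKick c (L₂.J a y) g) ∘
        coupleFun p (fun a y g => sphereKick c (L₁.J a y) g) := rfl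

/-- **The sweep's exact Jacobian is the product of the eq. (18) factors along the sweep**
(`CheckerboardSweep.hasJacobian_sweepEquiv`): w.r.t. `⊗_ι μ.toSphere`, the Jacobian of the sweep
is `sweepJac` — the `q`-class factors on the configuration after the `p`-class moved, times the
`p`-class factors. -/
theorem hasJacobian_kickSweepEquiv (μ : Measure V) [μ.IsAddHaarMeasure] :
    HasJacobian (Measure.pi fun _ : ι => μ.toSphere) (kickSweepEquiv n hV c L₁ L₂) fun U =>
      ENNReal.ofReal (sweepJac p q (fun a y g => sphereKick c (L₁.J a y) g)
        (classJac n c L₁) (classJac n c L₂) U) :=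
  hasJacobian_sweepEquiv μ.toSphere _ _ _ _ _ _ (measurable_classJac n c L₁)
    (hasJacobian_classKick n hV c L₁ μ) (classJac_nonneg n c L₁) (measurable_classJac n c L₂)
    (hasJacobian_classKick n hV c L₂ μ) (classJac_nonneg n c L₂)

/-- **THMC with the Engel–Schaefer sweep is exact (invariance).**  For every measurable
configuration weight `P ≥ 0` on `ι → S(V)` (the Boltzmann factor of the CP(N−1) action at fixed
links, say) and every update `κ` of the pulled-back variables that leaves
`(P ∘ F) · sweepJac · ⊗_ι μ.toSphere` invariant (`F` = the sweep; HMC for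
`S_eff = S ∘ F − Σ ln det 𝒥_n` with accept/reject, whatever the integrator), the update reported
through `F` — `conjKernel κ F`: pull back, update, push forward — leaves `P · ⊗_ι μ.toSphere`
invariant (`TransformedKernel.transformedUpdate_invariant`). -/
theorem kickSweep_thmc_invariant (μ : Measure V) [μ.IsAddHaarMeasure]
    {P : (ι → sphere (0 : V) 1) → ℝ≥0∞} (hP : Measurable P)
    {κ : Kernel (ι → sphere (0 : V) 1) (ι → sphere (0 : V) 1)}
    (hκ : Invariant κ ((Measure.pi fun _ : ι => μ.toSphere).withDensity fun U =>
      P (kickSweepEquiv n hV c L₁ L₂ U) *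
        ENNReal.ofReal (sweepJac p q (fun a y g => sphereKick c (L₁.J a y) g)
          (classJac n c L₁) (classJac n c L₂) U))) :
    Invariant (conjKernel κ (kickSweepEquiv n hV c L₁ L₂))
      ((Measure.pi fun _ : ι => μ.toSphere).withDensity P) :=
  transformedUpdate_invariant (hasJacobian_kickSweepEquiv n hV c L₁ L₂ μ) hP hκ

/-- **THMC with the Engel–Schaefer sweep is exact (detailed balance)**: the same for
reversibility (`TransformedKernel.transformedUpdate_isReversible`). -/
theorem kickSweep_thmc_isReversible (μ : Measure V) [μ.IsAddHaarMeasure]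
    {P : (ι → sphere (0 : V) 1) → ℝ≥0∞} (hP : Measurable P)
    {κ : Kernel (ι → sphere (0 : V) 1) (ι → sphere (0 : V) 1)}
    (hκ : IsReversible κ ((Measure.pi fun _ : ι => μ.toSphere).withDensity fun U =>
      P (kickSweepEquiv n hV c L₁ L₂ U) *
        ENNReal.ofReal (sweepJac p q (fun a y g => sphereKick c (L₁.J a y) g)
          (classJac n c L₁) (classJac n c L₂) U))) :
    IsReversible (conjKernel κ (kickSweepEquiv n hV c L₁ L₂))
      ((Measure.pi fun _ : ι => μ.toSphere).withDensity P) :=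
  transformedUpdate_isReversible (hasJacobian_kickSweepEquiv n hV c L₁ L₂ μ) hP hκ

end Sweep

end Summit.Ventures.LatticeQCDFlow.Exactness

end
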